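import Summits.CriticalPhenomena.PercolationContinuityZ3.Theses.PercNonProliferation
import Summits.CriticalPhenomena.PercolationContinuityZ3.Theorems.FreeBoxPowerSaving.Negative.FreeBoxPowerSavingOneArm
import Summits.CriticalPhenomena.PercolationContinuityZ3.Theorems.SubpolynomialBlocking.Negative.OffCritical

/-!
# Sketch (crux-ideate round 2, ideator 4) — crux stmt-CriticalPhenomena-4447 `FreeBoxPowerSaving`
# Card `onearm-currency-arm-cauchy-schwarz`: first lemmas, typed over tree declarations (no proofs except
# the one-line re-export of the landed one-arm reduction).

Notation: `P_p` bond percolation on `ℤ³`, `B(n) = box 3 n`, `π_p(m) = oneArmProb 3 p m = P_p(0 ↔ ∂ⁱⁿB(m))`,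
`FA₂ᵖ(n) = fa2 p n`, `u_n(p) = blockProb 3 p n = P_p(B(n) ↮ ∂ⁱⁿB(2n) in B(2n))`,
`E_p[N_n] = meanSpanning p n` (the finite layer-cake sum of the route items `MeanCauchySchwarz`/`SpanningBKCap`).
-/

namespace Summit.CriticalPhenomena.PercolationContinuityZ3.Cruxes.FreeBoxPowerSaving.OneArmCurrency

open MeasureTheory Filter Topology
open Literature.Probability.Percolation Literature.Probability.LatticeModels
open Summit.CriticalPhenomena.PercolationContinuityZ3.Theses.PercNonProliferation
open Summit.CriticalPhenomena.PercolationContinuityZ3.FreeBoxPowerSavingNegative (fa2 of_oneArm_decay)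
open Summit.CriticalPhenomena.PercolationContinuityZ3.Theorems.SubpolynomialBlocking.Negative (blockProb)
open scoped BigOperators

noncomputable section

/-- `E_p[N_n]`: the mean number of clusters of the open graph induced on `B(2n)` meeting both `B(n)` and
`∂ⁱⁿB(2n)`, as the finite layer-cake sum over representatives (verbatim the first factor of the route item
`MeanCauchySchwarz`). -/
def meanSpanning (p : unitInterval) (n : ℕ) : ℝ :=
  ∑ k ∈ Finset.range (box 3 n).card, (bondPercolation (zdGraph 3) p).real
    {ω | ∃ x : Fin (k + 1) → Site 3, (∀ i, x i ∈ box 3 n) ∧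
      (∀ i, ∃ y ∈ innerBoundary (zdGraph 3) (box 3 (2 * n)), ω ∈ openConnIn ↑(box 3 (2 * n)) (x i) y) ∧
      ∀ i j, i ≠ j → ω ∉ openConnIn ↑(box 3 (2 * n)) (x i) (x j)}

/-- The in-box ARM MASS `A_p(n) := Σ_{x ∈ B(n)} P_p(x ↔ ∂ⁱⁿB(2n) inside B(2n))` — the expected number of
points of the inner box joined to the outer boundary inside the outer box (replaces `θ(p)·|B(n)|` of
`MeanCauchySchwarz`; it does not vanish when `θ(p) = 0`). -/
def armMass (p : unitInterval) (n : ℕ) : ℝ :=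
  ∑ x ∈ box 3 n, (bondPercolation (zdGraph 3) p).real
    {ω | ∃ y ∈ innerBoundary (zdGraph 3) (box 3 (2 * n)), ω ∈ openConnIn ↑(box 3 (2 * n)) x y}

/-- `E_p[S_n]`: pairs of `B(n)` joined inside `B(2n)` (the second factor of `MeanCauchySchwarz`). -/
def pairsIn (p : unitInterval) (n : ℕ) : ℝ :=
  ∑ x ∈ box 3 n, ∑ y ∈ box 3 n, (bondPercolation (zdGraph 3) p).real (openConnIn ↑(box 3 (2 * n)) x y)

/-- **First lemma A (ArmCauchySchwarz; provable now, size M).** For every `p` and `n`: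
`A_p(n)² ≤ E_p[N_n] · E_p[S_n]`.  Pointwise: every `x ∈ B(n)` joined to `∂ⁱⁿB(2n)` inside `B(2n)` lies in a
spanning box-cluster, the spanning box-clusters containing a point of `B(n)` number `N`, so Cauchy–Schwarz over
the `≤ N` classes gives `(#armed points)² ≤ N · #(joined pairs)`; then `(E V)² ≤ E[V²/S]·E[S] ≤ E[N]·E[S]`
exactly as in the landed `meanCauchySchwarz_proof` (its `card_sq_le_card_mul_sum_card` with `percolatesAt`
replaced by the in-box arm event — the hypothesis `ω ⊆ E(ℤ³)` is then not even needed). -/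
def ArmCauchySchwarz : Prop :=
  ∀ (p : unitInterval) (n : ℕ), armMass p n ^ 2 ≤ meanSpanning p n * pairsIn p n

/-- **First lemma B (arm floor of the arm mass; provable now, size S).** `|B(n)| · π_p(3n) ≤ A_p(n)`:
for `x ∈ B(n)` one has `B(2n) ⊆ x + B(3n)`, so an open path from `x` to `x + ∂ⁱⁿB(3n)` first meets
`∂ⁱⁿB(2n)` through an initial segment inside `B(2n)`; translation invariance
(`bondPercolation_real_preimage_shift`). -/
def ArmFloor : Prop :=
  ∀ (p : unitInterval) (n : ℕ), ((box 3 n).card : ℝ) * oneArmProb 3 p (3 * n) ≤ armMass p n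

/-- **The arm–spanning–pair inequality (ASP; provable now from A, B, `pairsIn ≤ pairSum (2n)` and
`|B(2n)| ≤ 8|B(n)|`).** For every `p` and `n ≥ 1`:
`π_p(3n)² ≤ 64 · E_p[N_n] · FA₂ᵖ(2n)` — "(one-arm)² ≤ (mean spanning number) × (free pair connectivity)".
Dimension-free and sharp at the exponent level both for `d = 3` numerics (`n^{-0.95} ≤ O(1)·n^{-0.95}`) and in
mean field (`n^{-4} ≤ n^{d-6}·n^{2-d}`): the spanning number is EXACTLY the deficit in "arms meet". -/
def ArmSpanningPair : Prop :=
  ∀ (p : unitInterval) (n : ℕ), 1 ≤ n →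
    oneArmProb 3 p (3 * n) ^ 2 ≤ 64 * meanSpanning p n * fa2 p (2 * n)

/-- Polynomial one-arm decay at parameter `p` (as in Disproof §8 / `FreeBoxPowerSavingOneArm.lean`). -/
def OneArmPowerDecayAt (p : unitInterval) : Prop :=
  ∃ s C : ℝ, 0 < s ∧ ∀ m : ℕ, 1 ≤ m → oneArmProb 3 p m ≤ C * (m : ℝ) ^ (-s)

/-- **Closure of Disproof §8 into an equivalence inside the polynomial pair (provable now from ASP +
`SpanningBKCap` + monotonicity of `π` in `m`).**  `SubpolynomialBlocking ∧ FreeBoxPowerSaving(a) ⟹`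
one-arm decay with every exponent `< a/2`: `π(3n)² ≤ 64 · (1/u_n) · C (2n)^{-a} ≤ 64 C n^{s-a}` eventually.
Conversely `of_oneArm_decay` (landed p75695): exponent `s` gives the crux with `a = 2 min(s,1)`.  So, GIVEN the
pair's other member r4, the crux with exponent `a` IS one-arm decay with exponent `a/2` (lossless dictionary). -/
def PairGivesOneArm : Prop :=
  Summit.CriticalPhenomena.PercolationContinuityZ3.Theses.PercNonProliferation.SubpolynomialBlocking →
    FreeBoxPowerSaving → OneArmPowerDecayAt (criticalProbI 3)

/-- The landed half of the dictionary, re-exported: one-arm power decay at `p_c(ℤ³)` gives the crux. -/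
theorem crux_of_oneArmPowerDecay (h : OneArmPowerDecayAt (criticalProbI 3)) : FreeBoxPowerSaving := by
  obtain ⟨s, C, hs, hC⟩ := h
  exact of_oneArm_decay hs hC

/-- **Unconditional corollary of ASP with the landed `NonProliferation.expected_numSpanning_le_rpow`
(`E_{p_c}[N_n] ≤ C n^{2-β}`, β > 0):** a free-box power saving with exponent `a` gives one-arm decay with
exponent `(a - 2 + β)/2` — non-vacuous only for `a > 2 - β`, while any witness has `a ≤ 2` (Disproof §5). -/
def UnconditionalArmFromCrux : Prop :=
  ∃ β : ℝ, 0 < β ∧ ∀ a C : ℝ, 2 - β < a →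
    (∀ n : ℕ, 1 ≤ n → fa2 (criticalProbI 3) n ≤ C * (n : ℝ) ^ (-a)) →
      ∃ C' : ℝ, ∀ m : ℕ, 1 ≤ m → oneArmProb 3 (criticalProbI 3) m ≤ C' * (m : ℝ) ^ (-((a - 2 + β) / 2))

/-- **Transfer target C⁺ (summit-strength, declared): Cesàro blocking.**  The blocking probability of the
critical dyadic annuli is bounded below ON AVERAGE OVER SCALES:
`∃ c > 0, ∀ᶠ K, c·K ≤ Σ_{j<K} u_{2^j}(p_c)`.  Weaker than `X_B` (all scales) and incomparable with r4
(all scales, vanishing bound); false above six dimensions (crossings certain), like r2/r4. -/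
def CesaroBlocking : Prop :=
  ∃ c : ℝ, 0 < c ∧ ∀ᶠ K : ℕ in atTop,
    c * (K : ℝ) ≤ ∑ j ∈ Finset.range K, blockProb 3 (criticalProbI 3) (2 ^ j)

/-- **C⁺ ⟹ one-arm decay ⟹ crux (provable now, size M):** BK/Reimer over the nested dyadic annuli
(`bk_finitary_list`: an arm to `∂B(2^K)` crosses every annulus `B(2^{j+1}) ∖ B(2^j)`, `j < K`, by edge-disjoint
sub-paths) gives `π(2^K) ≤ Π_{j<K} (1 - u_{2^j}) ≤ exp(-Σ_{j<K} u_{2^j}) ≤ 2^{-cK/ln 2·…}`, i.e. one-arm decay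
with exponent `c / ln 2`, then `of_oneArm_decay`.  Cesàro blocking is the WEAKEST input of this (the only
rate-creating multi-scale) engine. -/
def CesaroBlockingGivesCrux : Prop :=
  CesaroBlocking → OneArmPowerDecayAt (criticalProbI 3)

end

end Summit.CriticalPhenomena.PercolationContinuityZ3.Cruxes.FreeBoxPowerSaving.OneArmCurrency
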